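import Summits.BirchSwinnertonDyer.Rank1Residual.X11b.KrausMinimalityGeneralTwo
import Summits.BirchSwinnertonDyer.Rank1Residual.X11b.CertificateCheckBridge
import Summits.BirchSwinnertonDyer.Rank1Residual.X11b.MultiplicativeDivisibilityRam
import Summits.BirchSwinnertonDyer.BirchSwinnertonDyer.Theorems.Rank1ResidualX11RankOneReduction
import HarnessLib

/-!
# BSD rank-≤1 residual cell, class X11b ∧ r = 1 ∧ p ≥ 5 with a (ram) prime: certificate records
# checked by ONE Bool function — `fullCheck` — and its soundness: `fullCheck r = true` plus the
# three engine numbers give `BSD(E,p)` for the record's curve (no per-record proof text)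

HONEST FRAMING (cell `b2b-bsdres-*`, verbatim): prove what is provable now; shrink each hard class
to its core with data; no claim beyond stated classes; COMBINATION classes deleted from PUBLISHED
theorems only, CONSTRUCTION-shaped remainder typed; this is not "finishing BSD". Class X11b stays
CONSTRUCTION-SHAPED; everything here is PER PAIR; nothing is booked; no named fact. Unit
`b2b-bsdres-x11c` (gen 9).

The window pipeline (`RecordsN20000Part{1,2}` + `Rank1ResidualX11RankOne*`, `SemistableRecords*`)
turns each record's finite conjuncts into kernel theorems with per-list `decide` certificates and
per-record Frobenius cards. For the beyond-window campaign (4 268 X11b ∧ p ≥ 5 lane-residue pairs,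
`N < 5·10⁵`) this file replaces all per-record proof text by four Bool checks on the record (schema
`X11RankOneCertificates.Record`), evaluated by `decide` per batch, and their SOUNDNESS, proved once:

* `minCheck` — per bad prime `(q, v_q N, v_q Δ)`: Silverman `q¹² ∤ Δ ∨ q⁴ ∤ c₄`, or `q = 2` and the
  integer Kraus test (`isMinimalAt_two_of_kraus_violated`), or `q = 3` and `3⁸ ‖ c₆`; with
  `checkSupport` (bad primes prime, `|Δ| = ∏ q^{v_q Δ}`) ⟹ `IsGloballyMinimal`
  (`isGloballyMinimal_of_krausCriterion_support`);
* `redCheck` — `p` prime by trial division, `5 ≤ p`, `p ∤ shaAn`, `p ∣ Δ ∧ p ∤ c₄`, a root / no root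
  `t < p` of the node-tangent quadratic per the split bit, a (ram) witness among the bad primes
  ⟹ `Mult`, split type, `Ram` (`Rank1ResidualIntModelReduction`);
* `irrCheck` — an odd prime `ℓ < 64`, `ℓ ≠ p`, `ℓ ∤ Δ`, with `X² − a_ℓX + ℓ` root-free mod `p` where
  `a_ℓ = ℓ + 1 − countPoints` (the schema's naive count = `#Ẽ(𝔽_ℓ)` by
  `natCard_point_eq_countPoints`) ⟹ `Irr` (Mazur 1978 Prop. 6.3 (1),
  `IntModel.hasIrreducibleModPGaloisRep_of_intModel_of_noroot`);
* `fullCheck := checkSupport ∧ minCheck ∧ redCheck ∧ irrCheck`; **`bsdp_of_fullCheck`**: a record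
  with `fullCheck r = true`, the published facts Skinner 2016 Thm. A (A31), Stein–Wuthrich 2013
  Thm. 6.1 split/non-split (A37), §4.2 height existence (A38), GZK (A18), modularity, and the three
  engine numbers (analytic rank `1`, `#Ш_an` as recorded, the two-engine certificate
  `CertSplit`/`CertNonsplit`) gives Miller's `BSD(E,p)` for `r.curve` — through the consumer of record
  `ClassX11b.bsdp_of_ram_{split,nonsplit}_of_certificate` (p206079); `bsdp_of_all_fullCheck` is the
  batch form (`rs.all fullCheck = true`).

References: J. H. Silverman, *AEC* (2009) VII.1 Rem. 1.1, VII.5 Prop. 5.1 [SilvermanAEC2009];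
A. Kraus, Acta Arith. 54 (1989) [Kraus1989]; B. Mazur, Invent. Math. 44 (1978) Prop. 6.3 (1)
[Mazur1978]; C. Skinner, Pacific J. Math. 283 (2016) Thm. A [Skinner2016PacificMC]; Stein–Wuthrich
2013 Thm. 6.1, §4.2 [SteinWuthrich2013]; Mazur–Tate–Teitelbaum 1986 [MazurTateTeitelbaum1986Invent].
-/

set_option autoImplicit false

noncomputable section

open scoped Classical MatrixGroups ModularForm

open CongruenceSubgroup WeierstrassCurve Literature.NumberTheory.EllipticCurves
  Literature.NumberTheory.EllipticCurves.ModularForms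
  Literature.NumberTheory.EllipticCurves.Rank1Residual
  Literature.NumberTheory.EllipticCurves.Rank1Residual.Typed
  Literature.NumberTheory.EllipticCurves.Skinner2016
  Literature.NumberTheory.EllipticCurves.Wuthrich2014
  Literature.NumberTheory.EllipticCurves.SteinWuthrich2013
  Literature.NumberTheory.EllipticCurves.Rank1Residual.X11RankOneCertificates
  Summit.BirchSwinnertonDyer.BirchSwinnertonDyer.Rank1Residual.IntModel
  Summit.BirchSwinnertonDyer.BirchSwinnertonDyer.Rank1Residual.X11RankOne

namespace Summit.BirchSwinnertonDyer.Rank1Residual.X11b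

/-! ### §1. The four checks -/

section Defs

/-- Per-prime minimality test on a bad-prime triple `(q, v_q N, v_q Δ)`: Silverman's `q¹² ∤ Δ` or
`q⁴ ∤ c₄`; or `q = 2`, `16 ∣ c₄`, `64 ∣ c₆` and the integer Kraus test; or `q = 3` and `3⁸ ‖ c₆`.
[cite: SilvermanAEC2009, VII.1 Remark 1.1] [cite: Kraus1989, Prop. 1 and Prop. 2] -/
def minCheckAt (a : List ℤ) (t : ℕ × ℕ × ℕ) : Bool :=
  decide (¬ (t.1 : ℤ) ^ 12 ∣ discOf a) || decide (¬ (t.1 : ℤ) ^ 4 ∣ c4Of a) ||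
  (t.1 == 2 && decide ((16 : ℤ) ∣ c4Of a) && decide ((64 : ℤ) ∣ c6Of a) &&
    decide (¬ (((16 : ℤ) ∣ c4Of a / 16 ∧ ((32 : ℤ) ∣ c6Of a / 64 ∨ (32 : ℤ) ∣ c6Of a / 64 - 8)) ∨
      (4 : ℤ) ∣ c6Of a / 64 + 1))) ||
  (t.1 == 3 && decide ((3 : ℤ) ^ 8 ∣ c6Of a) && decide (¬ (3 : ℤ) ^ 9 ∣ c6Of a))

/-- Minimality check of a record: `minCheckAt` at every listed bad prime. [folklore] -/
def minCheck (r : Record) : Bool := r.bad.all (minCheckAt r.ainvs)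

/-- The node-tangent quadratic `c₄t² + a₁c₄t − (54b₆ − 3b₂b₄ + a₂c₄)` of the integer model at
`t : ℕ` (its roots mod `p` decide split / non-split, `Rank1ResidualIntModelReduction`). [folklore] -/
def nodeQuad (a : List ℤ) (t : ℕ) : ℤ :=
  c4Of a * (t : ℤ) ^ 2 + a.getD 0 0 * c4Of a * t
    - (54 * (invariants a).2.2.1 - 3 * (invariants a).1 * (invariants a).2.1 + a.getD 1 0 * c4Of a)

/-- Reduction check of a record: `p` prime (trial division) and `≥ 5`, `p ∤ shaAn`, `p ∣ Δ`,
`p ∤ c₄`, a root (split) / no root (non-split) `t < p` of `nodeQuad`, and a (ram) witness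
`(ℓ, 1?, e)` among `bad`: `ℓ` prime, `ℓ ≠ p`, `ℓ ∣ Δ`, `ℓ ∤ c₄`, `ℓᵉ ‖ Δ`, `p ∤ e`.
[cite: SilvermanAEC2009, VII.5 Prop. 5.1] -/
def redCheck (r : Record) : Bool :=
  isPrimeBelow504100 r.p && decide (5 ≤ r.p) && decide (¬ r.p ∣ r.shaAn) &&
  decide ((r.p : ℤ) ∣ discOf r.ainvs) && decide (¬ (r.p : ℤ) ∣ c4Of r.ainvs) &&
  (if r.split then (List.range r.p).any (fun t => decide ((r.p : ℤ) ∣ nodeQuad r.ainvs t))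
    else (List.range r.p).all (fun t => decide (¬ (r.p : ℤ) ∣ nodeQuad r.ainvs t))) &&
  r.bad.any (fun b => isPrimeBelow504100 b.1 && decide (b.1 ≠ r.p) &&
    decide ((b.1 : ℤ) ∣ discOf r.ainvs) && decide (¬ (b.1 : ℤ) ∣ c4Of r.ainvs) &&
    decide ((b.1 : ℤ) ^ b.2.2 ∣ discOf r.ainvs) && decide (¬ (b.1 : ℤ) ^ (b.2.2 + 1) ∣ discOf r.ainvs) &&
    decide (¬ r.p ∣ b.2.2))

/-- Irreducibility witness at the prime `ℓ`: `ℓ` odd prime, `ℓ ≠ p`, `ℓ ∤ Δ`, and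
`X² − (ℓ + 1 − countPoints)X + ℓ` root-free mod `p`. [cite: Mazur1978, §6 Prop. 6.3 (1) (p. 153)] -/
def irrCheckAt (r : Record) (ℓ : ℕ) : Bool :=
  decide (3 ≤ ℓ) && isPrimeBelow504100 ℓ && decide (ℓ ≠ r.p) && decide (¬ (ℓ : ℤ) ∣ discOf r.ainvs) &&
  (List.range r.p).all (fun t =>
    decide (¬ (r.p : ℤ) ∣ (t : ℤ) ^ 2 - ((ℓ : ℤ) + 1 - countPoints r.ainvs ℓ) * t + ℓ))

/-- Irreducibility check: some witness prime `ℓ < 64`. [folklore] -/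
def irrCheck (r : Record) : Bool := (List.range 64).any (irrCheckAt r)

/-- The full check of a certificate record. [folklore] -/
def fullCheck (r : Record) : Bool := r.checkSupport && minCheck r && redCheck r && irrCheck r

end Defs

/-! ### §2. Soundness: support and the model -/

section Sound

variable (r : Record)

/-- Unpacking `checkSupport`: five a-invariants, bad primes prime, `|Δ(ainvs)| = ∏ q^{v_q Δ}`, `Δ ≠ 0`. [folklore] -/
theorem support_of_checkSupport (h : r.checkSupport = true) :
    r.ainvs.length = 5 ∧ (∀ t ∈ r.bad, t.1.Prime) ∧
      (discOf r.ainvs).natAbs = (r.bad.map fun t => t.1 ^ t.2.2).prod ∧ discOf r.ainvs ≠ 0 := by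
  simp only [Record.checkSupport, Bool.and_eq_true, decide_eq_true_eq, beq_iff_eq, List.all_eq_true] at h
  obtain ⟨⟨⟨⟨⟨hlen, hpr⟩, -⟩, -⟩, hprod⟩, hne⟩ := h
  refine ⟨hlen, fun t ht ↦ prime_of_isPrimeBelow504100 (hpr t ht).1, ?_, hne⟩
  rw [List.prod_eq_foldl]
  exact hprod.symm

/-- The five a-invariants of a record passing `checkSupport`. [folklore] -/
theorem exists_ainvs_of_checkSupport (h : r.checkSupport = true) :
    ∃ a1 a2 a3 a4 a6 : ℤ, r.ainvs = [a1, a2, a3, a4, a6] := by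
  have hlen := (support_of_checkSupport r h).1
  rcases hA : r.ainvs with _ | ⟨a1, _ | ⟨a2, _ | ⟨a3, _ | ⟨a4, _ | ⟨a6, _ | ⟨x, t⟩⟩⟩⟩⟩⟩ <;>
    simp [hA] at hlen
  exact ⟨a1, a2, a3, a4, a6, rfl⟩

/-- A record passing `checkSupport` has an elliptic curve (`Δ ≠ 0`). [folklore] -/
theorem isElliptic_of_checkSupport (h : r.checkSupport = true) : r.curve.IsElliptic := by
  obtain ⟨a1, a2, a3, a4, a6, hA⟩ := exists_ainvs_of_checkSupport r h
  have hne := (support_of_checkSupport r h).2.2.2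
  refine ⟨?_⟩
  rw [Record.Δ_curve_of_eq hA, isUnit_iff_ne_zero]
  rw [hA] at hne
  exact_mod_cast hne

/-- **Global minimality from `checkSupport ∧ minCheck`** (support-based Kraus/Silverman criterion,
no size bound). [cite: SilvermanAEC2009, VII.1 Remark 1.1 and VIII.8] [cite: Kraus1989, Prop. 1 and Prop. 2] -/
theorem isGloballyMinimal_of_minCheck (hs : r.checkSupport = true) (hm : minCheck r = true) :
    r.curve.IsGloballyMinimal := by
  obtain ⟨a1, a2, a3, a4, a6, hA⟩ := exists_ainvs_of_checkSupport r hs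
  obtain ⟨-, hprime, hprod, -⟩ := support_of_checkSupport r hs
  rw [Record.curve_of_eq hA]
  rw [hA] at hprod
  refine isGloballyMinimal_of_krausCriterion_support a1 a2 a3 a4 a6 r.bad hprime hprod fun t ht ↦ ?_
  have hmt : minCheckAt r.ainvs t = true := List.all_eq_true.mp hm t ht
  rw [hA] at hmt
  simp only [minCheckAt, Bool.or_eq_true, Bool.and_eq_true, decide_eq_true_eq, beq_iff_eq] at hmt
  rcases hmt with ((h12 | h4) | ⟨⟨⟨h2, h16⟩, h64⟩, hk⟩) | ⟨⟨h3, h8⟩, h9⟩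
  · exact Or.inl (Or.inl h12)
  · exact Or.inl (Or.inr h4)
  · exact Or.inr (Or.inl ⟨h2, h16, h64, hk⟩)
  · exact Or.inr (Or.inr ⟨h3, h8, h9⟩)

/-- A record passing `redCheck` has `p` prime, `5 ≤ p`, `p ∤ shaAn`. [folklore] -/
theorem prime_of_redCheck (h : redCheck r = true) : r.p.Prime ∧ 5 ≤ r.p ∧ ¬ r.p ∣ r.shaAn := by
  unfold redCheck at h
  simp only [Bool.and_eq_true, decide_eq_true_eq] at h
  exact ⟨prime_of_isPrimeBelow504100 h.1.1.1.1.1.1, h.1.1.1.1.1.2, h.1.1.1.1.2⟩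

/-- `ord_p (shaAn : ℚ) = 0` for a record passing `redCheck`. [folklore] -/
theorem padicValRat_shaAn_eq_zero_of_redCheck (h : redCheck r = true) :
    padicValRat r.p (r.shaAn : ℚ) = 0 := by
  rw [padicValRat.of_nat]
  exact_mod_cast padicValNat.eq_zero_of_not_dvd (prime_of_redCheck r h).2.2

/-- **`Mult`, split type, `Ram`, `Irr` for the record's curve from `checkSupport ∧ redCheck ∧ irrCheck`**
(any instances). [cite: SilvermanAEC2009, VII.5 Prop. 5.1] [cite: Mazur1978, §6 Prop. 6.3 (1) (p. 153)] -/
theorem reduction_of_checks [Fact r.p.Prime] [r.curve.IsElliptic] [r.curve.IsGloballyMinimal]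
    (hs : r.checkSupport = true) (hred : redCheck r = true) (hirr : irrCheck r = true) :
    Mult r.curve r.p ∧ (r.split = true → r.curve.HasSplitMultiplicativeReductionAtPrime r.p) ∧
    (r.split = false → ¬ r.curve.HasSplitMultiplicativeReductionAtPrime r.p) ∧
    Ram r.curve r.p ∧ Irr r.curve r.p := by
  haveI : NeZero r.p := ⟨(Fact.out : r.p.Prime).ne_zero⟩
  obtain ⟨a1, a2, a3, a4, a6, hA⟩ := exists_ainvs_of_checkSupport r hs
  -- unpack `redCheck`
  have hred' := hred
  unfold redCheck at hred'
  simp only [Bool.and_eq_true, decide_eq_true_eq, List.any_eq_true] at hred'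
  obtain ⟨⟨⟨⟨-, hpΔ⟩, hpc4⟩, hsplit⟩, ⟨b', hb'mem, hb'⟩⟩ := hred'
  obtain ⟨⟨⟨⟨⟨⟨hprime', hne'⟩, hΔ'⟩, hc4'⟩, he⟩, he'⟩, hpe⟩ := hb'
  -- unpack `irrCheck`
  have hirr' := hirr
  unfold irrCheck at hirr'
  obtain ⟨ℓ, -, hℓ⟩ := List.any_eq_true.mp hirr'
  unfold irrCheckAt at hℓ
  simp only [Bool.and_eq_true, decide_eq_true_eq, List.all_eq_true, List.mem_range] at hℓ
  obtain ⟨⟨⟨⟨hℓ3, hℓprime⟩, hℓp⟩, hℓΔ⟩, hnoroot⟩ := hℓ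
  rw [hA] at hpΔ hpc4 hsplit hΔ' hc4' he he' hℓΔ hnoroot
  set E₀ : WeierstrassCurve ℤ := ⟨a1, a2, a3, a4, a6⟩ with hE₀
  have hI : integralModelInt r.curve = E₀ := integralModelInt_curve r hA
  have hΔ : E₀.Δ = discOf [a1, a2, a3, a4, a6] := intCurve_Δ a1 a2 a3 a4 a6
  have hc4 : E₀.c₄ = c4Of [a1, a2, a3, a4, a6] := intCurve_c₄ a1 a2 a3 a4 a6
  have hb2 := intCurve_b₂ a1 a2 a3 a4 a6
  have hb4 := intCurve_b₄ a1 a2 a3 a4 a6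
  have hb6 := intCurve_b₆ a1 a2 a3 a4 a6
  have hpΔ' : (r.p : ℤ) ∣ E₀.Δ := by rw [hΔ]; exact hpΔ
  have hpc4' : ¬ (r.p : ℤ) ∣ E₀.c₄ := by rw [hc4]; exact hpc4
  have hnode : ∀ t : ℕ,
      ((E₀.c₄ : ZMod r.p) * (t : ZMod r.p) ^ 2 + (E₀.a₁ * E₀.c₄ : ZMod r.p) * (t : ZMod r.p)
        - (54 * E₀.b₆ - 3 * E₀.b₂ * E₀.b₄ + E₀.a₂ * E₀.c₄ : ZMod r.p)) =
      ((nodeQuad [a1, a2, a3, a4, a6] t : ℤ) : ZMod r.p) := by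
    intro t
    rw [hc4, hb2, hb4, hb6]
    simp only [hE₀, nodeQuad, List.getD_cons_zero, List.getD_cons_succ]
    push_cast
    ring
  refine ⟨hasMultiplicativeReductionAtPrime_of_intModel hI r.p hpΔ' hpc4', ?_, ?_, ?_, ?_⟩
  · intro hsp
    rw [hsp] at hsplit
    simp only [if_true, List.any_eq_true, List.mem_range, decide_eq_true_eq] at hsplit
    obtain ⟨t, -, ht⟩ := hsplit
    refine hasSplitMultiplicativeReductionAtPrime_of_intModel_of_root hI r.p hpΔ' hpc4' ⟨(t : ZMod r.p), ?_⟩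
    rw [hnode, ZMod.intCast_zmod_eq_zero_iff_dvd]
    exact ht
  · intro hsp
    rw [hsp] at hsplit
    simp only [Bool.false_eq_true, if_false, List.all_eq_true, List.mem_range, decide_eq_true_eq] at hsplit
    refine not_hasSplitMultiplicativeReductionAtPrime_of_intModel_of_noroot hI r.p hpΔ' hpc4'
      (forall_zmod_of_forall_lt fun t ht ↦ ?_)
    rw [hnode, Ne, ZMod.intCast_zmod_eq_zero_iff_dvd]
    exact hsplit t ht
  · exact ram_of_intModel hI r.p b'.1 (prime_of_isPrimeBelow504100 hprime') hne'
      (by rw [hΔ]; exact hΔ') (by rw [hc4]; exact hc4') (e := b'.2.2) (by rw [hΔ]; exact he)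
      (by rw [hΔ]; exact he') hpe
  · haveI hℓP : Fact ℓ.Prime := ⟨prime_of_isPrimeBelow504100 hℓprime⟩
    have hℓ2 : ℓ ≠ 2 := by omega
    have hℓΔ' : ¬ (ℓ : ℤ) ∣ E₀.Δ := by rw [hΔ]; exact hℓΔ
    have hcardZ := natCard_point_eq_countPoints a1 a2 a3 a4 a6 ℓ hℓ2 hℓΔ'
    set n : ℕ := Nat.card ((E₀.map (Int.castRingHom (ZMod ℓ))).toAffine.Point) with hn
    have hcp : countPoints [a1, a2, a3, a4, a6] ℓ = (n : ℤ) := hcardZ.symm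
    refine hasIrreducibleModPGaloisRep_of_intModel_of_noroot hI r.p ℓ hℓp hℓΔ' (n := n) rfl
      (forall_zmod_of_forall_lt fun t ht h0 ↦ hnoroot t ht ?_)
    rw [← ZMod.intCast_zmod_eq_zero_iff_dvd, hcp]
    push_cast at h0 ⊢
    linear_combination h0

end Sound

/-! ### §3. From `fullCheck` and the three numbers to `BSD(E,p)` -/

section Final

variable (r : Record)

/-- Unpacking `fullCheck`. [folklore] -/
theorem fullCheck_iff : fullCheck r = true ↔
    r.checkSupport = true ∧ minCheck r = true ∧ redCheck r = true ∧ irrCheck r = true := by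
  simp only [fullCheck, Bool.and_eq_true, and_assoc]

/-- **A record passing `fullCheck`, SPLIT at `p`: the published facts A31 (Skinner 2016 Thm. A), A37,
A38, A18 + modularity and the three engine numbers give `BSD(E,p)`** (consumer of record
`ClassX11b.bsdp_of_ram_split_of_certificate`, all bookkeeping from the checks and tree theorems).
[cite: Skinner2016PacificMC, Thm. A (§1), §3.2] [cite: SteinWuthrich2013, Thm. 6.1 (p. 20) and §4.2] -/
theorem bsdp_of_fullCheck_split (hc : fullCheck r = true)
    [Fact r.p.Prime] [r.curve.IsElliptic] [r.curve.IsGloballyMinimal]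
    (hA : thmA_charIdeal_multiplicative) (hJ : thm61_splitMultiplicative)
    (hH : exists_isSplitMultCanonical) (hGZK : rank_eq_analyticRank_of_analyticRank_le_one)
    (hpar : nonempty_modularParametrizationData)
    (hsplit : r.split = true) (hran : r.curve.analyticRank = 1)
    (hsha : Literature.NumberTheory.EllipticCurves.shaAn r.curve = ((r.shaAn : ℚ) : ℂ))
    (hcs : r.CertSplit) : BSDp r.curve r.p := by
  obtain ⟨hs, -, hred, hirr⟩ := (fullCheck_iff r).mp hc
  obtain ⟨hmult, hsp, -, hram, hirr'⟩ := reduction_of_checks r hs hred hirr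
  have hp5 : 5 ≤ r.p := (prime_of_redCheck r hred).2.1
  have hX : ClassX11b r.curve r.p := ⟨hran, by omega, hmult, hirr'⟩
  have hsplit' := hsp hsplit
  obtain ⟨κ, hκ, γ, hγ, hγ'⟩ := exists_isCyclotomic_isTopGenerator_isCyclotomicVariable_holds r.p
  obtain ⟨D⟩ := r.curve.nonempty_selmerDualData_holds κ γ hγ
  haveI : NeZero (r.curve.conductorNorm ℤ) := ⟨(r.curve.conductorNorm_pos_holds).ne'⟩
  obtain ⟨Dm⟩ := hpar r.curve
  obtain ⟨ϖ, hϖpos, hϖ, -⟩ := Dm.exists_rat_mul_realPeriodRat_eq_plusPeriod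
  obtain ⟨L, hL⟩ := exists_isSplitMultPAdicLFunctionOf hsplit' Dm.isNewformOf
  obtain ⟨Dq⟩ := (nonempty_tateParameterData_iff_holds (W := r.curve) (p := r.p)).mpr hsplit'
  have hrank : r.curve.mordellWeilRank = 1 := by rw [(hGZK r.curve (le_of_eq hran)).1, hran]
  obtain ⟨hordL, hcert⟩ := hcs Dm.f ϖ L Dm.isNewformOf hϖ hL
  exact X11b.ClassX11b.bsdp_of_ram_split_of_certificate hA hJ hH hGZK r.curve r.p (by omega) hX hram Dq
    hκ hγ hγ' Dm.isNewformOf D ϖ hϖpos.ne' hϖ L hL (by rw [hrank]; exact hordL)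
    (fun Dh hDh => by rw [hrank]; exact hcert Dq Dh hDh) hsha (padicValRat_shaAn_eq_zero_of_redCheck r hred)

/-- **A record passing `fullCheck`, NON-SPLIT at `p`: `BSD(E,p)`** likewise (MTT non-split
`p`-adic `L`-function from the tree theorem `exists_isMultPAdicLFunctionOf_neg_one_holds`).
[cite: Skinner2016PacificMC, Thm. A (§1), §3.2] [cite: SteinWuthrich2013, Thm. 6.1 (p. 20), §3.1 (p. 9), §4.2]
[cite: MazurTateTeitelbaum1986Invent, §I.10–I.14] -/
theorem bsdp_of_fullCheck_nonsplit (hc : fullCheck r = true)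
    [Fact r.p.Prime] [r.curve.IsElliptic] [r.curve.IsGloballyMinimal]
    (hA : thmA_charIdeal_multiplicative) (hJ : thm61_nonsplitMultiplicative)
    (hH : exists_isMultCanonical) (hGZK : rank_eq_analyticRank_of_analyticRank_le_one)
    (hpar : nonempty_modularParametrizationData)
    (hsplit : r.split = false) (hran : r.curve.analyticRank = 1)
    (hsha : Literature.NumberTheory.EllipticCurves.shaAn r.curve = ((r.shaAn : ℚ) : ℂ))
    (hcn : r.CertNonsplit) : BSDp r.curve r.p := by
  obtain ⟨hs, -, hred, hirr⟩ := (fullCheck_iff r).mp hc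
  obtain ⟨hmult, -, hnsp, hram, hirr'⟩ := reduction_of_checks r hs hred hirr
  have hp5 : 5 ≤ r.p := (prime_of_redCheck r hred).2.1
  have hX : ClassX11b r.curve r.p := ⟨hran, by omega, hmult, hirr'⟩
  have hns := hnsp hsplit
  obtain ⟨κ, hκ, γ, hγ, hγ'⟩ := exists_isCyclotomic_isTopGenerator_isCyclotomicVariable_holds r.p
  obtain ⟨D⟩ := r.curve.nonempty_selmerDualData_holds κ γ hγ
  haveI : NeZero (r.curve.conductorNorm ℤ) := ⟨(r.curve.conductorNorm_pos_holds).ne'⟩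
  obtain ⟨Dm⟩ := hpar r.curve
  obtain ⟨ϖ, hϖpos, hϖ, -⟩ := Dm.exists_rat_mul_realPeriodRat_eq_plusPeriod
  obtain ⟨L, hL⟩ := exists_isMultPAdicLFunctionOf_neg_one_holds r.curve r.p Dm.f hmult hns Dm.isNewformOf
  obtain ⟨q, ⟨hq0, hq1, hqj⟩, -⟩ := existsUnique_tateJ_eq_of_one_lt_norm
    (one_lt_norm_j_of_hasMultiplicativeReductionAtPrime (W := r.curve) (p := r.p) hmult)
  have hrank : r.curve.mordellWeilRank = 1 := by rw [(hGZK r.curve (le_of_eq hran)).1, hran]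
  obtain ⟨hordL, hcert⟩ := hcn Dm.f ϖ L Dm.isNewformOf hϖ hL
  exact X11b.ClassX11b.bsdp_of_ram_nonsplit_of_certificate hA hJ hH hGZK r.curve r.p (by omega) hX hram
    hns hq0 hq1 hqj hκ hγ hγ' Dm.isNewformOf D ϖ hϖpos.ne' hϖ L hL (by rw [hrank]; exact hordL)
    (fun Dh hDh => by rw [hrank, pow_one]; simpa using hcert q hq0 hq1 hqj Dh hDh) hsha
    (padicValRat_shaAn_eq_zero_of_redCheck r hred)

/-- **SOUNDNESS OF `fullCheck` — the whole per-pair content of a beyond-window certificate record.**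
For a record `r` with `fullCheck r = true` (kernel-evaluated): Skinner 2016 Thm. A `hA`,
Stein–Wuthrich 2013 Thm. 6.1 `hJs`/`hJn`, SW §4.2 height existence `hHs`/`hHn`, GZK `hGZK`,
modularity `hpar` (published named facts) and the three engine numbers — analytic rank `= 1`,
`#Ш_an` as recorded, the two-engine `p`-adic certificate — give Miller's `BSD(E,p)` for `r.curve`.
`p` prime, `Δ ≠ 0`, global minimality, `Mult`, split type, `Ram`, `Irr` are all read off the check.
Per pair; class label unchanged. [cite: Skinner2016PacificMC, Thm. A]
[cite: SteinWuthrich2013, Thm. 6.1 (p. 20) and §4.2] [cite: MazurTateTeitelbaum1986Invent, §I.10–I.14 and §II.10]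
[cite: Mazur1978, §6 Prop. 6.3 (1) (p. 153)] -/
theorem bsdp_of_fullCheck (hc : fullCheck r = true)
    (hA : thmA_charIdeal_multiplicative)
    (hJs : thm61_splitMultiplicative) (hJn : thm61_nonsplitMultiplicative)
    (hHs : exists_isSplitMultCanonical) (hHn : exists_isMultCanonical)
    (hGZK : rank_eq_analyticRank_of_analyticRank_le_one) (hpar : nonempty_modularParametrizationData)
    (hnum : ∀ [Fact r.p.Prime] [r.curve.IsElliptic] [r.curve.IsGloballyMinimal],
        r.curve.analyticRank = 1 ∧
        Literature.NumberTheory.EllipticCurves.shaAn r.curve = ((r.shaAn : ℚ) : ℂ) ∧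
        (r.split = true → r.CertSplit) ∧ (r.split = false → r.CertNonsplit)) :
    ∀ [Fact r.p.Prime] [r.curve.IsElliptic] [r.curve.IsGloballyMinimal], BSDp r.curve r.p := by
  intro _ _ _
  obtain ⟨hran, hsha, hcs, hcn⟩ := hnum
  cases hsp : r.split
  · exact bsdp_of_fullCheck_nonsplit r hc hA hJn hHn hGZK hpar hsp hran hsha (hcn hsp)
  · exact bsdp_of_fullCheck_split r hc hA hJs hHs hGZK hpar hsp hran hsha (hcs hsp)

/-- The instance facts of a record passing `fullCheck`: `p` prime, `Δ ≠ 0`, global minimality —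
all from the check. [folklore] -/
theorem instances_of_fullCheck (hc : fullCheck r = true) :
    r.p.Prime ∧ r.curve.IsElliptic ∧ r.curve.IsGloballyMinimal := by
  obtain ⟨hs, hm, hred, -⟩ := (fullCheck_iff r).mp hc
  exact ⟨(prime_of_redCheck r hred).1, isElliptic_of_checkSupport r hs, isGloballyMinimal_of_minCheck r hs hm⟩

/-- **Batch form**: for a list `rs` with `rs.all fullCheck = true` (one `decide` per batch file),
every listed record's curve satisfies `BSD(E,p)` given the published facts and its three numbers —
with NO instance hypothesis. [cite: Skinner2016PacificMC, Thm. A] [cite: SteinWuthrich2013, Thm. 6.1 (p. 20) and §4.2] -/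
theorem bsdp_of_all_fullCheck {rs : List Record} (hall : rs.all fullCheck = true)
    (hA : thmA_charIdeal_multiplicative)
    (hJs : thm61_splitMultiplicative) (hJn : thm61_nonsplitMultiplicative)
    (hHs : exists_isSplitMultCanonical) (hHn : exists_isMultCanonical)
    (hGZK : rank_eq_analyticRank_of_analyticRank_le_one) (hpar : nonempty_modularParametrizationData)
    (hnum : ∀ r ∈ rs, ∀ [Fact r.p.Prime] [r.curve.IsElliptic] [r.curve.IsGloballyMinimal],
        r.curve.analyticRank = 1 ∧
        Literature.NumberTheory.EllipticCurves.shaAn r.curve = ((r.shaAn : ℚ) : ℂ) ∧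
        (r.split = true → r.CertSplit) ∧ (r.split = false → r.CertNonsplit))
    (r : Record) (hr : r ∈ rs) :
    ∃ (_ : Fact r.p.Prime) (_ : r.curve.IsElliptic) (_ : r.curve.IsGloballyMinimal), BSDp r.curve r.p := by
  have hc : fullCheck r = true := List.all_eq_true.mp hall r hr
  obtain ⟨hp, hE, hM⟩ := instances_of_fullCheck r hc
  haveI : Fact r.p.Prime := ⟨hp⟩
  haveI := hE
  haveI := hM
  exact ⟨inferInstance, hE, hM, bsdp_of_fullCheck r hc hA hJs hJn hHs hHn hGZK hpar (hnum r hr)⟩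

end Final

end Summit.BirchSwinnertonDyer.Rank1Residual.X11b

end
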